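import Summits.ResolutionOfSingularities.ResolutionOfSingularities.Theorems.FrobeniusClosingSteerGenericGame
import HarnessLib

/-!
# Crux `Steer` (stmt-ResolutionOfSingularities-16345) — the exponent game GENERICALLY, part 2: Perron uniformisation, monomialisation of
# finitely many Laurent monomials and odd-support reduction for ANY step relation closed under a pair-step dichotomy

OURS (campaign res-hironaka, rung L ★L-G4, slot W4.1; res-D-brk-2 g6; tool for K-TX part 4 and for every future re-lettering bookkeeping).
Candidates, not facts; NOT a statement of H. Hironaka's manuscript [claim: Hironaka2017, status: under-review]; AI formalisation, weaker than expert
review; `--supports stmt-ResolutionOfSingularities-16345`, counted 0.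

## What is proved

The two landed instances (`…SteerToricVertexPerron`/`…ToricVertexExit` for `Relettering`, `…ToricUnitExitPerron`/`…Monomial` for `KRel`)
re-ran the same induction; this file proves it ONCE for an abstract state type `S` and a step relation `P : S → S → (transformer) → Prop`
with a goodness predicate `good`, assuming only: `hrefl` (`P s s id` on good states), `htrans` (transformers compose), `hgood` (targets are
good), `hstep` (for good `s` and `a ≠ b`, SOME orientation of the pair step is available: transformer `f ↦ update f a (f a + f b)` or
`f ↦ update f b (f b + f a)`), `hneg` (`T (-f) = -T f`); plus, where values are needed, letters `ltr : S → Fin n → K` in `O ∖ 0` on good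
states with `hmono` (`ltr s' ^ (T f) = ltr s ^ f`), `hnn` (ℕ-vectors preserved), `hoddp` (odd coordinates preserved).
* `generic_uniform` — every exponent vector becomes `≥ 0` or `≤ 0` (termination lex(M, c, m): §1 bookkeeping, now PUBLIC);
* `generic_nonneg`, `generic_nonneg_family` — Laurent monomials of value `< 1` become `ℕ`-monomials;
* `generic_single_odd` — an `ℕ`-vector with an odd coordinate acquires exactly one odd coordinate.
[cite: Teissier2014] [folklore]
-/

noncomputable section

-- single-problem summit: the doubled namespace component `ResolutionOfSingularities` is forced
set_option linter.dupNamespace false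

open scoped BigOperators

namespace Summit.ResolutionOfSingularities.ResolutionOfSingularities.Theorems.SteerGenericPerron

section Generic

variable {K : Type} [Field K] {n : ℕ} {S : Type}
  (P : S → S → ((Fin n → ℤ) → (Fin n → ℤ)) → Prop) (good : S → Prop)
  (hrefl : ∀ s, good s → P s s id)
  (htrans : ∀ {s s' s'' : S} {T T' : (Fin n → ℤ) → (Fin n → ℤ)}, P s s' T → P s' s'' T' → P s s'' (T' ∘ T))
  (hgood : ∀ {s s' : S} {T : (Fin n → ℤ) → (Fin n → ℤ)}, P s s' T → good s')
  (hstep : ∀ s, good s → ∀ {a b : Fin n}, a ≠ b →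
    (∃ s', P s s' (fun f => Function.update f a (f a + f b))) ∨ (∃ s', P s s' (fun f => Function.update f b (f b + f a))))
  (hneg : ∀ {s s' : S} {T : (Fin n → ℤ) → (Fin n → ℤ)}, P s s' T → ∀ f, T (-f) = -T f)

include hrefl htrans hgood hstep hneg

/-! ## §2 Perron: uniform sign (generic step relation) -/

/-- The core of the game, positive orientation: there is a POSITIVE letter of maximal absolute value. Induction on
lex(`M`, `c`, `negs`). OURS. [folklore] -/
theorem generic_perron_pos :
    ∀ (Mv cv mv : ℕ) (s : S) (_ : good s) (e : Fin n → ℤ),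
      M e = Mv → cnt e = cv → negs e = mv → (∃ a, 0 < e a ∧ (e a).natAbs = M e) →
      ∃ s' T, P s s' T ∧ Uniform (T e) := by
  intro Mv
  induction Mv using Nat.strong_induction_on with
  | _ Mv ihM =>
  intro cv
  induction cv using Nat.strong_induction_on with
  | _ cv ihc =>
  intro mv
  induction mv using Nat.strong_induction_on with
  | _ mv ihm =>
  intro s hs e hMe hce hme hpos
  classical
  obtain ⟨a, ha0, haM⟩ := hpos
  -- if no negative letter, `e` is uniform already
  by_cases hneg : ∀ j, 0 ≤ e j
  · exact ⟨s, id, hrefl s hs, Or.inl hneg⟩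
  push Not at hneg
  obtain ⟨b, hb⟩ := hneg
  have hab : a ≠ b := by rintro rfl; exact absurd ha0 (not_lt.mpr hb.le)
  have heaM : e a = (M e : ℤ) := by
    rw [← haM, Int.natCast_natAbs]; exact (abs_of_pos ha0).symm
  -- generic facts about the two possible new values
  have hwabs : (e a + e b).natAbs < M e := by
    have hMpos : (0 : ℤ) < M e := by rw [← heaM]; exact ha0
    have hb1 : -((e b).natAbs : ℤ) ≤ e b := by rw [Int.natCast_natAbs]; exact neg_abs_le (e b)
    have hb2 : ((e b).natAbs : ℤ) ≤ M e := by exact_mod_cast natAbs_le_M e b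
    have h1 : e a + e b < M e := by rw [← heaM]; linarith
    have h2 : -(M e : ℤ) < e a + e b := by rw [heaM] at ha0 ⊢; linarith
    have h3 : ((e a + e b).natAbs : ℤ) < M e := by
      rw [Int.natCast_natAbs]
      exact abs_lt.mpr ⟨h2, h1⟩
    exact_mod_cast h3
  -- blow up the pair (a, b) in the orientation chosen by `O`
  rcases hstep s hs hab with ⟨s', hR⟩ | ⟨s', hR⟩
  · -- pivot `a`: the `M`-letter `a` is replaced by `e a + e b`, of absolute value `< M e` ⇒ (M, c) drops
    set e' : Fin n → ℤ := Function.update e a (e a + e b) with he'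
    have hlex := lex_lt_of_update_max e a haM (e a + e b) hwabs
    -- orientation of `e'`: either uniform, or recurse
    by_cases hunif : Uniform e'
    · exact ⟨s', _, hR, hunif⟩
    · -- `e'` is not uniform; find a relettering for `e'` by the outer inductions, in the right orientation
      have hrec : ∃ s'' T', P s' s'' T' ∧ Uniform (T' e') := by
        -- decide orientation of e'
        have hne : ∃ j, e' j ≠ 0 := by
          by_contra hcon
          push Not at hcon
          exact hunif (Or.inl fun j => (hcon j).symm.le)
        obtain ⟨j₀, hj₀⟩ := hne
        by_cases hor : ∃ a', 0 < e' a' ∧ (e' a').natAbs = M e'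
        · rcases hlex with hlt | ⟨hMeq, hclt⟩
          · exact ihM (M e') (hMe ▸ hlt) (cnt e') (negs e') s' (hgood hR) e' rfl rfl rfl hor
          · exact ihc (cnt e') (hce ▸ hclt) (negs e') s' (hgood hR) e' (hMeq.trans hMe) rfl rfl hor
        · -- all `M`-letters of `e'` are non-positive: pass to `-e'`
          have hor' : ∃ a', 0 < (-e') a' ∧ ((-e') a').natAbs = M (-e') := by
            obtain ⟨j, hj⟩ := exists_natAbs_eq_M e' j₀
            have hMneg : M (-e') = M e' := by simp [M]
            have hjle : e' j ≤ 0 := by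
              by_contra hcon
              push Not at hcon
              exact hor ⟨j, hcon, hj⟩
            have hjne : e' j ≠ 0 := by
              intro h0; rw [h0] at hj; simp at hj; exact absurd hj.symm (M_pos e' hj₀).ne'
            refine ⟨j, ?_, ?_⟩
            · simp; exact lt_of_le_of_ne hjle hjne
            · simp [hMneg, hj]
          have hMneg : M (-e') = M e' := by simp [M]
          have hcneg : cnt (-e') = cnt e' := by simp [cnt, M]
          rcases hlex with hlt | ⟨hMeq, hclt⟩
          · obtain ⟨s'', T', hR', hU⟩ :=
              ihM (M (-e')) (by rw [hMneg, ← hMe]; exact hlt) (cnt (-e')) (negs (-e')) s' (hgood hR) (-e') rfl rfl rfl hor'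
            refine ⟨s'', T', hR', ?_⟩
            rw [hneg hR'] at hU
            exact (uniform_neg_iff _).mp hU
          · obtain ⟨s'', T', hR', hU⟩ :=
              ihc (cnt (-e')) (by rw [hcneg, ← hce]; exact hclt) (negs (-e')) s' (hgood hR) (-e')
                (by rw [hMneg, hMeq, hMe]) rfl rfl hor'
            refine ⟨s'', T', hR', ?_⟩
            rw [hneg hR'] at hU
            exact (uniform_neg_iff _).mp hU
      obtain ⟨s'', T', hR', hU⟩ := hrec
      exact ⟨s'', _, htrans hR hR', hU⟩
  · -- pivot `b`: the negative letter `b` is replaced by `e b + e a = e a + e b`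
    set e' : Fin n → ℤ := Function.update e b (e b + e a) with he'
    by_cases hunif : Uniform e'
    · exact ⟨s', _, hR, hunif⟩
    · have hrec : ∃ s'' T', P s' s'' T' ∧ Uniform (T' e') := by
        by_cases hbM : (e b).natAbs = M e
        · -- `b` was an `M`-letter too: (M, c) drops
          have hwabs' : (e b + e a).natAbs < M e := by rw [add_comm]; exact hwabs
          have hlex := lex_lt_of_update_max e b hbM (e b + e a) hwabs'
          have hne : ∃ j, e' j ≠ 0 := by
            by_contra hcon; push Not at hcon
            exact hunif (Or.inl fun j => (hcon j).symm.le)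
          obtain ⟨j₀, hj₀⟩ := hne
          by_cases hor : ∃ a', 0 < e' a' ∧ (e' a').natAbs = M e'
          · rcases hlex with hlt | ⟨hMeq, hclt⟩
            · exact ihM (M e') (hMe ▸ hlt) (cnt e') (negs e') s' (hgood hR) e' rfl rfl rfl hor
            · exact ihc (cnt e') (hce ▸ hclt) (negs e') s' (hgood hR) e' (hMeq.trans hMe) rfl rfl hor
          · have hMneg : M (-e') = M e' := by simp [M]
            have hcneg : cnt (-e') = cnt e' := by simp [cnt, M]
            have hor' : ∃ a', 0 < (-e') a' ∧ ((-e') a').natAbs = M (-e') := by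
              obtain ⟨j, hj⟩ := exists_natAbs_eq_M e' j₀
              have hjle : e' j ≤ 0 := by
                by_contra hcon; push Not at hcon; exact hor ⟨j, hcon, hj⟩
              have hjne : e' j ≠ 0 := by
                intro h0; rw [h0] at hj; simp at hj; exact absurd hj.symm (M_pos e' hj₀).ne'
              exact ⟨j, by simp; exact lt_of_le_of_ne hjle hjne, by simp [hMneg, hj]⟩
            rcases hlex with hlt | ⟨hMeq, hclt⟩
            · obtain ⟨s'', T', hR', hU⟩ :=
                ihM (M (-e')) (by rw [hMneg, ← hMe]; exact hlt) (cnt (-e')) (negs (-e')) s' (hgood hR) (-e') rfl rfl rfl hor'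
              exact ⟨s'', T', hR', by rw [hneg hR'] at hU; exact (uniform_neg_iff _).mp hU⟩
            · obtain ⟨s'', T', hR', hU⟩ :=
                ihc (cnt (-e')) (by rw [hcneg, ← hce]; exact hclt) (negs (-e')) s' (hgood hR) (-e')
                  (by rw [hMneg, hMeq, hMe]) rfl rfl hor'
              exact ⟨s'', T', hR', by rw [hneg hR'] at hU; exact (uniform_neg_iff _).mp hU⟩
        · -- `b` was not an `M`-letter: (M, c) unchanged, `a` still a positive `M`-letter, `negs` drops
          have hbM' : (e b).natAbs < M e := lt_of_le_of_ne (natAbs_le_M e b) hbM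
          have hwabs' : (e b + e a).natAbs < M e := by rw [add_comm]; exact hwabs
          obtain ⟨hMeq, hceq⟩ := M_cnt_update_of_ne_max e b hbM' (e b + e a) hwabs'
          have hw0 : 0 ≤ e b + e a := by
            -- `e a = M e > |e b|`
            have h3 : ((e b).natAbs : ℤ) < M e := by exact_mod_cast hbM'
            have hb1 : -((e b).natAbs : ℤ) ≤ e b := by rw [Int.natCast_natAbs]; exact neg_abs_le (e b)
            rw [heaM]
            linarith
          have hnlt := negs_update_lt e b hb (e b + e a) hw0
          have hor : ∃ a', 0 < e' a' ∧ (e' a').natAbs = M e' := by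
            refine ⟨a, ?_, ?_⟩
            · rw [he', Function.update_of_ne hab]; exact ha0
            · rw [he', Function.update_of_ne hab, hMeq]; exact haM
          exact ihm (negs e') (hme ▸ hnlt) s' (hgood hR) e' (hMeq.trans hMe) (hceq.trans hce) rfl hor
      obtain ⟨s'', T', hR', hU⟩ := hrec
      exact ⟨s'', _, htrans hR hR', hU⟩

/-- **Perron monomialisation of one Laurent monomial, exponent-game form**: along any valuation ring there is an admissible
re-lettering after which the exponent vector has a uniform sign. OURS. [folklore] -/
theorem generic_uniform (s : S) (hs : good s) (e : Fin n → ℤ) :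
    ∃ (s' : S) (T : (Fin n → ℤ) → (Fin n → ℤ)), P s s' T ∧
      ((∀ j, 0 ≤ T e j) ∨ (∀ j, T e j ≤ 0)) := by
  classical
  by_cases hunif : Uniform e
  · exact ⟨s, id, hrefl s hs, hunif⟩
  have hne : ∃ j, e j ≠ 0 := by
    by_contra hcon; push Not at hcon
    exact hunif (Or.inl fun j => (hcon j).symm.le)
  obtain ⟨j₀, hj₀⟩ := hne
  by_cases hor : ∃ a, 0 < e a ∧ (e a).natAbs = M e
  · exact generic_perron_pos P good hrefl htrans hgood hstep hneg _ _ _ s hs e rfl rfl rfl hor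
  · have hMneg : M (-e) = M e := by simp [M]
    have hor' : ∃ a, 0 < (-e) a ∧ ((-e) a).natAbs = M (-e) := by
      obtain ⟨j, hj⟩ := exists_natAbs_eq_M e j₀
      have hjle : e j ≤ 0 := by
        by_contra hcon; push Not at hcon; exact hor ⟨j, hcon, hj⟩
      have hjne : e j ≠ 0 := by
        intro h0; rw [h0] at hj; simp at hj; exact absurd hj.symm (M_pos e hj₀).ne'
      exact ⟨j, by simp; exact lt_of_le_of_ne hjle hjne, by simp [hMneg, hj]⟩
    obtain ⟨s', T, hR, hU⟩ := generic_perron_pos P good hrefl htrans hgood hstep hneg _ _ _ s hs (-e) rfl rfl rfl hor'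
    refine ⟨s', T, hR, ?_⟩
    rw [hneg hR] at hU
    exact (uniform_neg_iff _).mp hU

/-! ## §3 Odd-support reduction (generic step relation) -/

omit hneg in
/-- **Odd-support reduction**: a vector with some odd coordinate becomes, after an admissible re-lettering along `O`, a vector with
exactly one odd coordinate. OURS. [folklore] -/
theorem generic_single_odd :
    ∀ (N : ℕ) (s : S) (_ : good s) (p : Fin n → ℤ)
      (_ : (Finset.univ.filter fun j => Odd (p j)).card ≤ N) (_ : ∃ j, Odd (p j)),
      ∃ (s' : S) (T : (Fin n → ℤ) → (Fin n → ℤ)), P s s' T ∧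
        ∃ a, Odd (T p a) ∧ ∀ j, j ≠ a → Even (T p j) := by
  classical
  intro N
  induction N with
  | zero =>
    intro s hs p hsc hodd
    obtain ⟨j, hj⟩ := hodd
    have : j ∈ (Finset.univ.filter fun j => Odd (p j)) := by simp [hj]
    exact absurd hsc (not_le.mpr (Finset.card_pos.mpr ⟨j, this⟩))
  | succ N ih =>
    intro s hs p hsc hodd
    obtain ⟨a, ha⟩ := hodd
    by_cases hone : ∀ j, j ≠ a → Even (p j)
    · exact ⟨s, id, hrefl s hs, a, ha, hone⟩
    push Not at hone
    obtain ⟨b, hba, hb⟩ := hone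
    rw [Int.not_even_iff_odd] at hb
    -- blow up the pair (a, b) of odd letters
    rcases hstep s hs hba.symm with ⟨s₁, hR₁⟩ | ⟨s₁, hR₁⟩
    · -- pivot `a`
      have hlt := generic_card_odd_update_lt p hba.symm ha hb
      have hodd₁ : ∃ j, Odd (Function.update p a (p a + p b) j) := ⟨b, by rw [Function.update_of_ne hba]; exact hb⟩
      obtain ⟨s₂, T₂, hR₂, a', ha', hrest⟩ :=
        ih s₁ (hgood hR₁) _ (Nat.lt_succ_iff.mp (lt_of_lt_of_le hlt hsc)) hodd₁
      exact ⟨s₂, _, htrans hR₁ hR₂, a', ha', hrest⟩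
    · -- pivot `b`
      have hlt := generic_card_odd_update_lt p hba hb ha
      have hodd₁ : ∃ j, Odd (Function.update p b (p b + p a) j) := ⟨a, by rw [Function.update_of_ne hba.symm]; exact ha⟩
      obtain ⟨s₂, T₂, hR₂, a', ha', hrest⟩ :=
        ih s₁ (hgood hR₁) _ (Nat.lt_succ_iff.mp (lt_of_lt_of_le hlt hsc)) hodd₁
      exact ⟨s₂, _, htrans hR₁ hR₂, a', ha', hrest⟩


variable (O : ValuationSubring K) (ltr : S → Fin n → K)
  (hmono : ∀ {s s' : S} {T : (Fin n → ℤ) → (Fin n → ℤ)}, P s s' T → ∀ f, (∏ j, ltr s' j ^ T f j) = ∏ j, ltr s j ^ f j)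
  (hO : ∀ s, good s → ∀ j, ltr s j ∈ O) (h0 : ∀ s, good s → ∀ j, ltr s j ≠ 0)

include hmono hO h0

/-- **Perron monomialisation of a Laurent monomial of positive value**: if `z ^ e ∈ 𝔪_O` (value `< 1`), then after an admissible
re-lettering it is an `ℕ`-monomial in the new letters. OURS. [folklore] -/
theorem generic_nonneg (s : S) (hs : good s) (e : Fin n → ℤ) (he : O.valuation (∏ j, ltr s j ^ e j) < 1) :
    ∃ (s' : S) (T : (Fin n → ℤ) → (Fin n → ℤ)), P s s' T ∧
      (∀ j, 0 ≤ T e j) := by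
  obtain ⟨s', T, hR, hU⟩ := generic_uniform P good hrefl htrans hgood hstep hneg s hs e
  refine ⟨s', T, hR, ?_⟩
  rcases hU with hU | hU
  · exact hU
  · -- all exponents `≤ 0`: then `(z^e)⁻¹ = z' ^ (-T e)` lies in `O`, contradicting `v(z^e) < 1`
    exfalso
    have hinv : (∏ j, ltr s j ^ e j)⁻¹ ∈ O := by
      rw [← hmono hR e, ← Finset.prod_inv_distrib]
      refine prod_mem fun j _ => ?_
      rw [← zpow_neg]
      obtain ⟨c, hc⟩ := Int.exists_eq_neg_ofNat (hU j)
      rw [hc, neg_neg, zpow_natCast]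
      exact pow_mem (hO _ (hgood hR) j) c
    have hne : (∏ j, ltr s j ^ e j) ≠ 0 := Finset.prod_ne_zero_iff.mpr fun j _ => zpow_ne_zero _ (h0 _ hs j)
    have h1 : O.valuation ((∏ j, ltr s j ^ e j)⁻¹) ≤ 1 := (O.valuation_le_one_iff _).mpr hinv
    rw [map_inv₀, inv_le_one₀ (zero_lt_iff.mpr ((map_ne_zero _).mpr hne))] at h1
    exact absurd he (not_lt.mpr h1)

variable (hnn : ∀ {s s' : S} {T : (Fin n → ℤ) → (Fin n → ℤ)}, P s s' T → ∀ f : Fin n → ℤ, (∀ j, 0 ≤ f j) → ∀ j, 0 ≤ T f j)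

include hnn

/-- **Perron monomialisation of finitely many Laurent monomials of positive value at once.** OURS. [folklore] -/
theorem generic_nonneg_family :
    ∀ (m : ℕ) (s : S) (_ : good s) (F : Fin m → Fin n → ℤ)
      (_ : ∀ i, O.valuation (∏ j, ltr s j ^ F i j) < 1),
      ∃ (s' : S) (T : (Fin n → ℤ) → (Fin n → ℤ)), P s s' T ∧
        ∀ i j, 0 ≤ T (F i) j := by
  intro m
  induction m with
  | zero =>
    intro s hs F _
    exact ⟨s, id, hrefl s hs, fun i => i.elim0⟩
  | succ m ih =>
    intro s hs F hF
    -- first monomialise `F 0`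
    obtain ⟨s₁, T₁, hR₁, h0'⟩ := generic_nonneg P good hrefl htrans hgood hstep hneg O ltr hmono hO h0 s hs (F 0) (hF 0)
    -- the remaining targets, re-expressed in the new letters
    have hF' : ∀ i : Fin m, O.valuation (∏ j, ltr s₁ j ^ T₁ (F i.succ) j) < 1 := fun i => by
      rw [hmono hR₁]; exact hF i.succ
    obtain ⟨s₂, T₂, hR₂, hrest⟩ := ih s₁ (hgood hR₁) (fun i => T₁ (F i.succ)) hF'
    refine ⟨s₂, T₂ ∘ T₁, htrans hR₁ hR₂, fun i => ?_⟩
    refine Fin.cases ?_ (fun i => ?_) i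
    · exact hnn hR₂ _ h0'
    · exact hrest i



end Generic

end Summit.ResolutionOfSingularities.ResolutionOfSingularities.Theorems.SteerGenericPerron

end
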